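import Mathlib
import Literature.NumberTheory.Sieve.ParityBarrier

/-!
# Crux `QuadraticOmegaParity` (stmt-Parity-11585), line `Sketch` (ladder), junction 1:
# λ-cancellation at `q = 1` for every irreducible quadratic ⇒ λ-cancellation along every AP

For the Liouville form of the crux (Mathlib's `ArithmeticFunction.liouville`, with `λ 0 = 0`):
if `Σ_{n ≤ x} λ(f(n).toNat) = o(x)` for EVERY irreducible `f ∈ ℤ[X]` of degree `2` with positive
leading coefficient, then `Σ_{n ≤ x, n ≡ a (mod q)} λ(f(n).toNat) = o(x)` for every such `f`, every
modulus `q ≥ 1` and every residue `a`.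

Proof (DILATION; the combinatorial and algebraic lemmas are adapted from the crux's standing
disproof analysis `Cruxes/QuadraticOmegaParity/Disproof.lean`, §3d, which does the same for `ω`):

* substituting `n = q·m + a₀` (`a₀ = a mod q`) turns the progression sum for `f` into the FULL sum
  for the dilated quadratic `g = f(qX + a₀)` over `m ≤ ⌊(x − a₀)/q⌋`, up to one boundary term of
  absolute value `≤ 1` (`abs_sum_sub_sum_dilate_le`, using the tree's
  `Literature.NumberTheory.Sieve.abs_liouville_le_one`);
* `g = c · h` with `c ≥ 1` and `h` irreducible of degree `2` with positive leading coefficient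
  (content × primitive part, Gauss's lemma, "no rational roots"; `dilate_eq_content_mul`);
* `λ((c·v).toNat) = λ(c) · λ(v.toNat)` EXACTLY for all `c : ℕ`, `v : ℤ` (complete
  multiplicativity of `λ`; both sides vanish when `v < 0`), so the full sum for `g` is `λ(c)` times
  the full sum for `h` (`sum_liouville_C_mul`), which is `o(y)` by hypothesis;
* compose with `y = ⌊(x − a₀)/q⌋ → ∞`, `y ≤ x`, and absorb the `O(1)` boundary term.

Main result: `Summit.Parity.BatemanHorn.Theorems.liouvilleQ1_to_liouvilleAP` (registered alias
`Summit.Parity.BatemanHorn.Theorems.stub_liouvilleQ1_to_AP`). Everything is [folklore]; no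
definitions are introduced.
-/

namespace Summit.Parity.BatemanHorn.Theorems

open Filter Asymptotics Polynomial

namespace LiouvilleQ1ToAP

/-! ### The Liouville weight

(`|λ(k)| ≤ 1` is the tree's `Literature.NumberTheory.Sieve.abs_liouville_le_one`.) -/

/-- `λ((c·v).toNat) = λ(c)·λ(v.toNat)` for `c : ℕ`, `v : ℤ`: complete multiplicativity of `λ`
when `v ≥ 0`, and both sides vanish when `v < 0` (`λ 0 = 0`). -/
theorem liouville_toNat_natCast_mul (c : ℕ) (v : ℤ) :
    ArithmeticFunction.liouville (((c : ℤ) * v).toNat) =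
      ArithmeticFunction.liouville c * ArithmeticFunction.liouville v.toNat := by
  rcases le_or_gt 0 v with hv | hv
  · rw [Int.toNat_mul (Int.natCast_nonneg c) hv, Int.toNat_natCast,
      ArithmeticFunction.liouville_apply_mul]
  · have h1 : ((c : ℤ) * v).toNat = 0 :=
      Int.toNat_eq_zero.mpr (mul_nonpos_of_nonneg_of_nonpos (Int.natCast_nonneg c) hv.le)
    have h2 : v.toNat = 0 := Int.toNat_eq_zero.mpr hv.le
    rw [h1, h2, ArithmeticFunction.map_zero, mul_zero]

/-- The full `λ`-sum of a content multiple: `Σ λ((c·h(m)).toNat) = λ(c) · Σ λ(h(m).toNat)`. -/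
theorem sum_liouville_C_mul (c : ℕ) (h : ℤ[X]) (s : Finset ℕ) :
    ∑ m ∈ s, (ArithmeticFunction.liouville (((C (c : ℤ) * h).eval (m : ℤ)).toNat) : ℝ) =
      (ArithmeticFunction.liouville c : ℝ) *
        ∑ m ∈ s, (ArithmeticFunction.liouville ((h.eval (m : ℤ)).toNat) : ℝ) := by
  rw [Finset.mul_sum]
  refine Finset.sum_congr rfl fun m _ => ?_
  rw [eval_mul, eval_C, liouville_toNat_natCast_mul, Int.cast_mul]

/-! ### The substitution `n = q·m + a₀` -/

-- adapted from Cruxes/QuadraticOmegaParity/Disproof.lean (`filter_modEq_eq_image`)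
/-- The index set of the substitution `n = q·m + a₀`, `a₀ = a mod q`. -/
theorem filter_modEq_eq_image (q a x : ℕ) :
    (Finset.Icc 1 x).filter (fun n : ℕ => n ≡ a [MOD q]) =
      ((Finset.range (x + 1)).filter (fun m : ℕ => 1 ≤ q * m + a % q ∧ q * m + a % q ≤ x)).image
        (fun m : ℕ => q * m + a % q) := by
  ext n
  simp only [Finset.mem_filter, Finset.mem_Icc, Finset.mem_image, Finset.mem_range]
  constructor
  · rintro ⟨⟨h1, h2⟩, hmod⟩
    refine ⟨n / q, ⟨?_, ?_⟩, ?_⟩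
    · exact Nat.lt_succ_of_le ((Nat.div_le_self n q).trans h2)
    · have : q * (n / q) + a % q = n := by rw [← hmod]; exact Nat.div_add_mod n q
      rw [this]; exact ⟨h1, h2⟩
    · rw [← hmod]; exact Nat.div_add_mod n q
  · rintro ⟨m, ⟨-, hb1, hb2⟩, rfl⟩
    refine ⟨⟨hb1, hb2⟩, ?_⟩
    rw [Nat.ModEq, add_comm, Nat.add_mul_mod_self_left, Nat.mod_mod]

-- adapted from Cruxes/QuadraticOmegaParity/Disproof.lean (`eval_dilate`)
/-- The dilated polynomial `f(qX + a₀)` evaluates as `f` along the progression. -/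
theorem eval_dilate (f : ℤ[X]) (q a₀ m : ℕ) :
    (f.comp (C (q : ℤ) * X + C (a₀ : ℤ))).eval (m : ℤ) = f.eval ((q * m + a₀ : ℕ) : ℤ) := by
  rw [eval_comp, eval_add, eval_mul, eval_C, eval_X, eval_C]
  push_cast
  ring_nf

-- adapted from Cruxes/QuadraticOmegaParity/Disproof.lean (`abs_S_sub_S_dilate_le`)
/-- **Substitution.** The progression `λ`-sum for `f` and the full `λ`-sum for `g = f(qX + a₀)`
over `m ≤ ⌊(x − a₀)/q⌋` differ by at most one term (the one with `m = 0`), of absolute value `≤ 1`. -/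
theorem abs_sum_sub_sum_dilate_le (f : ℤ[X]) {q : ℕ} (hq : 0 < q) (a x : ℕ) :
    |(∑ n ∈ (Finset.Icc 1 x).filter (fun n : ℕ => n ≡ a [MOD q]),
        (ArithmeticFunction.liouville ((f.eval (n : ℤ)).toNat) : ℝ)) -
      ∑ m ∈ Finset.Icc 1 ((x - a % q) / q),
        (ArithmeticFunction.liouville
          (((f.comp (C (q : ℤ) * X + C ((a % q : ℕ) : ℤ))).eval (m : ℤ)).toNat) : ℝ)| ≤ 1 := by
  set a₀ := a % q with ha₀
  set Y := (x - a₀) / q with hY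
  set g := f.comp (C (q : ℤ) * X + C (a₀ : ℤ)) with hg
  set t : ℕ → ℝ := fun m => (ArithmeticFunction.liouville ((g.eval (m : ℤ)).toNat) : ℝ) with ht
  set M := (Finset.range (x + 1)).filter (fun m : ℕ => 1 ≤ q * m + a₀ ∧ q * m + a₀ ≤ x) with hM
  -- the progression sum, reindexed
  have hinj : Set.InjOn (fun m : ℕ => q * m + a₀) M := by
    intro m _ m' _ hmm
    have : q * m = q * m' := by simpa using hmm
    exact Nat.eq_of_mul_eq_mul_left hq this
  have hS1 : (∑ n ∈ (Finset.Icc 1 x).filter (fun n : ℕ => n ≡ a [MOD q]),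
      (ArithmeticFunction.liouville ((f.eval (n : ℤ)).toNat) : ℝ)) = ∑ m ∈ M, t m := by
    rw [filter_modEq_eq_image q a x, Finset.sum_image hinj]
    refine Finset.sum_congr rfl fun m _ => ?_
    simp only [ht, hg, eval_dilate]
  -- `Icc 1 Y ⊆ M` and `M \ Icc 1 Y ⊆ {0}`
  have hsub : Finset.Icc 1 Y ⊆ M := by
    intro m hm
    rw [Finset.mem_Icc] at hm
    have h1 : q * m ≤ x - a₀ := by rw [mul_comm]; exact (Nat.le_div_iff_mul_le hq).mp hm.2
    have h2 : q ≤ q * m := Nat.le_mul_of_pos_right q hm.1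
    have h5 : m ≤ q * m := Nat.le_mul_of_pos_left m hq
    have h3 : a₀ < x := Nat.lt_of_sub_pos (by omega)
    rw [hM, Finset.mem_filter, Finset.mem_range]
    exact ⟨by omega, by omega, by omega⟩
  have hdiff : M \ Finset.Icc 1 Y ⊆ {0} := by
    intro m hm
    rw [Finset.mem_sdiff, hM, Finset.mem_filter, Finset.mem_Icc] at hm
    rw [Finset.mem_singleton]
    have hmY : m ≤ Y := (Nat.le_div_iff_mul_le hq).mpr (by rw [mul_comm]; omega)
    omega
  rw [hS1, ← Finset.sum_sdiff_eq_sub hsub]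
  refine (Finset.abs_sum_le_sum_abs _ _).trans ?_
  calc ∑ m ∈ M \ Finset.Icc 1 Y, |t m| ≤ ∑ m ∈ M \ Finset.Icc 1 Y, (1 : ℝ) :=
        Finset.sum_le_sum fun m _ => Literature.NumberTheory.Sieve.abs_liouville_le_one _
    _ = ((M \ Finset.Icc 1 Y).card : ℝ) := by
        rw [Finset.sum_const, nsmul_eq_mul, mul_one]
    _ ≤ 1 := by
        exact_mod_cast (Finset.card_le_card hdiff).trans (Finset.card_singleton 0).le

-- adapted from Cruxes/QuadraticOmegaParity/Disproof.lean (`tendsto_dilate_index`)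
/-- `⌊(x − a₀)/q⌋ → ∞` as `x → ∞` (`q ≥ 1`). -/
theorem tendsto_dilate_index (q a₀ : ℕ) (hq : 0 < q) :
    Tendsto (fun x : ℕ => (x - a₀) / q) atTop atTop := by
  refine tendsto_atTop_atTop.mpr fun b => ⟨q * b + a₀, fun x hx => ?_⟩
  exact (Nat.le_div_iff_mul_le hq).mpr (by rw [mul_comm]; omega)

-- adapted from Cruxes/QuadraticOmegaParity/Disproof.lean (`isLittleO_of_abs_sub_le`)
/-- A uniformly bounded difference does not affect `o(x)`. -/
theorem isLittleO_of_abs_sub_le {u v : ℕ → ℝ} {C : ℝ} (h : ∀ x, |u x - v x| ≤ C)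
    (hv : v =o[atTop] fun x : ℕ => (x : ℝ)) : u =o[atTop] fun x : ℕ => (x : ℝ) := by
  have h1 : (fun x => u x - v x) =O[atTop] (fun _ : ℕ => (1 : ℝ)) :=
    IsBigO.of_bound C (Eventually.of_forall fun x => by
      simpa only [Real.norm_eq_abs, abs_one, mul_one] using h x)
  have h2 : (fun _ : ℕ => (1 : ℝ)) =o[atTop] (fun x : ℕ => (x : ℝ)) := by
    rw [Asymptotics.isLittleO_one_left_iff]
    simpa only [Real.norm_natCast] using tendsto_natCast_atTop_atTop
  have h3 := (h1.trans_isLittleO h2).add hv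
  simpa only [sub_add_cancel] using h3

/-! ### The dilated quadratic is a content multiple of an irreducible quadratic -/

-- adapted from Cruxes/QuadraticOmegaParity/Disproof.lean (`roots_comp_linear_eq_zero`)
/-- A nonzero polynomial over `ℚ` without rational roots, composed with a non-constant linear
polynomial, still has no rational roots. -/
theorem roots_comp_linear_eq_zero {F : ℚ[X]} (hF : F.roots = 0) (hF0 : F ≠ 0) {u v : ℚ}
    (hu : u ≠ 0) : (F.comp (C u * X + C v)).roots = 0 := by
  by_contra hne
  obtain ⟨r, hr⟩ := Multiset.exists_mem_of_ne_zero hne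
  have hG0 : F.comp (C u * X + C v) ≠ 0 := by
    rw [Ne, comp_eq_zero_iff, not_or]
    refine ⟨hF0, fun h => ?_⟩
    have h1 := congrArg natDegree h.2
    rw [natDegree_linear hu, natDegree_C] at h1
    exact one_ne_zero h1
  rw [mem_roots hG0, IsRoot, eval_comp] at hr
  have : (C u * X + C v).eval r ∈ F.roots := (mem_roots hF0).mpr hr
  rw [hF] at this
  exact Multiset.notMem_zero _ this

-- adapted from Cruxes/QuadraticOmegaParity/Disproof.lean (`dilate_eq_content_mul`)
/-- **The dilated quadratic is `c·h`** with `c ≥ 1` and `h` (primitive) irreducible of degree `2`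
with positive leading coefficient: content × primitive part, Gauss's lemma, and "a rational
quadratic without rational roots is irreducible". -/
theorem dilate_eq_content_mul {f : ℤ[X]} (hf : Irreducible f) (hd : f.natDegree = 2)
    (hl : 0 < f.leadingCoeff) {q : ℕ} (hq : 0 < q) (a₀ : ℕ) :
    ∃ c : ℕ, c ≠ 0 ∧ ∃ h : ℤ[X], Irreducible h ∧ h.natDegree = 2 ∧ 0 < h.leadingCoeff ∧
      f.comp (C (q : ℤ) * X + C (a₀ : ℤ)) = C (c : ℤ) * h := by
  have hqz : (q : ℤ) ≠ 0 := by exact_mod_cast hq.ne'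
  set g := f.comp (C (q : ℤ) * X + C (a₀ : ℤ)) with hg
  have hLd : (C (q : ℤ) * X + C (a₀ : ℤ)).natDegree = 1 := natDegree_linear hqz
  have hgd : g.natDegree = 2 := by rw [hg, natDegree_comp, hd, hLd]
  have hgl : g.leadingCoeff = f.leadingCoeff * (q : ℤ) ^ 2 := by
    rw [hg, leadingCoeff_comp (by rw [hLd]; exact one_ne_zero), leadingCoeff_linear hqz, hd]
  have hglpos : 0 < g.leadingCoeff := by rw [hgl]; positivity
  have hg0 : g ≠ 0 := leadingCoeff_ne_zero.mp hglpos.ne'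
  -- content and primitive part
  have hc0 : g.content ≠ 0 := fun h0 => hg0 (content_eq_zero_iff.mp h0)
  have hcnn : 0 ≤ g.content := Int.nonneg_of_normalize_eq_self normalize_content
  have hcpos : 0 < g.content := lt_of_le_of_ne hcnn (Ne.symm hc0)
  refine ⟨g.content.toNat, by omega, g.primPart, ?_, ?_, ?_, ?_⟩
  rotate_left
  · rw [natDegree_primPart, hgd]
  · have h1 : g.leadingCoeff = g.content * g.primPart.leadingCoeff := by
      conv_lhs => rw [g.eq_C_content_mul_primPart, leadingCoeff_mul, leadingCoeff_C]
    rw [h1] at hglpos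
    exact (mul_pos_iff_of_pos_left hcpos).mp hglpos
  · rw [Int.toNat_of_nonneg hcnn]; exact g.eq_C_content_mul_primPart
  -- irreducibility of the primitive part, via Gauss and "no rational roots"
  rw [Polynomial.IsPrimitive.Int.irreducible_iff_irreducible_map_cast (isPrimitive_primPart g)]
  have hfprim : f.IsPrimitive := hf.isPrimitive (by rw [hd]; exact two_ne_zero)
  have hF : Irreducible (f.map (Int.castRingHom ℚ)) :=
    (Polynomial.IsPrimitive.Int.irreducible_iff_irreducible_map_cast hfprim).mp hf
  have hFd : (f.map (Int.castRingHom ℚ)).natDegree = 2 := by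
    rw [natDegree_map_eq_of_injective (Int.castRingHom ℚ).injective_int, hd]
  have hF0 : f.map (Int.castRingHom ℚ) ≠ 0 := hF.ne_zero
  have hFroots : (f.map (Int.castRingHom ℚ)).roots = 0 :=
    (irreducible_iff_roots_eq_zero_of_degree_le_three (by rw [hFd]) (by rw [hFd]; norm_num)).mp hF
  have hqQ : ((q : ℤ) : ℚ) ≠ 0 := by exact_mod_cast hq.ne'
  have hGeq : g.map (Int.castRingHom ℚ) =
      (f.map (Int.castRingHom ℚ)).comp (C ((q : ℤ) : ℚ) * X + C ((a₀ : ℤ) : ℚ)) := by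
    rw [hg, map_comp, Polynomial.map_add, Polynomial.map_mul, map_C, map_X, map_C, eq_intCast,
      eq_intCast]
  have hGd : (g.map (Int.castRingHom ℚ)).natDegree = 2 := by
    rw [natDegree_map_eq_of_injective (Int.castRingHom ℚ).injective_int, hgd]
  have hGroots : (g.map (Int.castRingHom ℚ)).roots = 0 := by
    rw [hGeq]; exact roots_comp_linear_eq_zero hFroots hF0 hqQ
  have hG : Irreducible (g.map (Int.castRingHom ℚ)) :=
    (irreducible_iff_roots_eq_zero_of_degree_le_three (by rw [hGd]) (by rw [hGd]; norm_num)).mpr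
      hGroots
  have hGsplit : g.map (Int.castRingHom ℚ) =
      C ((g.content : ℤ) : ℚ) * (g.primPart).map (Int.castRingHom ℚ) := by
    conv_lhs => rw [g.eq_C_content_mul_primPart]
    rw [Polynomial.map_mul, map_C, eq_intCast]
  have hunit : IsUnit (C ((g.content : ℤ) : ℚ)) :=
    isUnit_C.mpr (isUnit_iff_ne_zero.mpr (by exact_mod_cast hc0))
  rw [hGsplit] at hG
  exact (associated_unit_mul_left _ _ hunit).irreducible hG

end LiouvilleQ1ToAP

open LiouvilleQ1ToAP in
/-- **Junction 1 of line `Sketch` for the crux `QuadraticOmegaParity`.** If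
`Σ_{n ≤ x} λ(f(n).toNat) = o(x)` for every irreducible `f ∈ ℤ[X]` of degree `2` with positive
leading coefficient, then `Σ_{n ≤ x, n ≡ a (mod q)} λ(f(n).toNat) = o(x)` for every such `f`, every
`q ≥ 1` and every `a` (dilation `n = q·m + a₀`, `f(qX + a₀) = c·h`, `λ(c·h(m)) = λ(c)·λ(h(m))`). -/
theorem liouvilleQ1_to_liouvilleAP :
    (∀ f : ℤ[X], Irreducible f → f.natDegree = 2 → 0 < f.leadingCoeff →
      (fun x : ℕ => ∑ n ∈ Finset.Icc 1 x, (ArithmeticFunction.liouville ((f.eval (n : ℤ)).toNat) : ℝ))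
        =o[atTop] fun x : ℕ => (x : ℝ)) →
    ∀ f : ℤ[X], Irreducible f → f.natDegree = 2 → 0 < f.leadingCoeff → ∀ q a : ℕ, 0 < q →
      (fun x : ℕ => ∑ n ∈ (Finset.Icc 1 x).filter (fun n : ℕ => n ≡ a [MOD q]),
        (ArithmeticFunction.liouville ((f.eval (n : ℤ)).toNat) : ℝ)) =o[atTop] fun x : ℕ => (x : ℝ) := by
  intro H f hf hd hl q a hq
  obtain ⟨c, -, h, hh, hhd, hhl, hgh⟩ := dilate_eq_content_mul hf hd hl hq (a % q)
  -- the full sum for `g = f(qX + a₀) = c·h` is `λ(c)` times the full sum for `h`, hence `o(y)`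
  have hsum : ∀ y : ℕ, ∑ m ∈ Finset.Icc 1 y, (ArithmeticFunction.liouville
      (((f.comp (C (q : ℤ) * X + C ((a % q : ℕ) : ℤ))).eval (m : ℤ)).toNat) : ℝ) =
        (ArithmeticFunction.liouville c : ℝ) *
          ∑ m ∈ Finset.Icc 1 y, (ArithmeticFunction.liouville ((h.eval (m : ℤ)).toNat) : ℝ) :=
    fun y => by rw [hgh, sum_liouville_C_mul]
  have h0 : (fun y : ℕ => ∑ m ∈ Finset.Icc 1 y, (ArithmeticFunction.liouville
      (((f.comp (C (q : ℤ) * X + C ((a % q : ℕ) : ℤ))).eval (m : ℤ)).toNat) : ℝ)) =o[atTop]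
      fun y : ℕ => (y : ℝ) :=
    ((H h hh hhd hhl).const_mul_left (ArithmeticFunction.liouville c : ℝ)).congr_left
      fun y => (hsum y).symm
  -- compose with `y = ⌊(x − a₀)/q⌋ → ∞`, `y ≤ x`
  have h1 := h0.comp_tendsto (tendsto_dilate_index q (a % q) hq)
  have h2 : (fun x : ℕ => (((x - a % q) / q : ℕ) : ℝ)) =O[atTop] fun x : ℕ => (x : ℝ) :=
    IsBigO.of_bound 1 (Eventually.of_forall fun x => by
      rw [Real.norm_natCast, Real.norm_natCast, one_mul]
      exact_mod_cast (Nat.div_le_self _ _).trans (Nat.sub_le _ _))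
  have h3 := h1.trans_isBigO h2
  -- absorb the boundary term
  exact isLittleO_of_abs_sub_le (C := 1) (fun x => abs_sum_sub_sum_dilate_le f hq a x) h3

/-- Registered stub `stub_liouvilleQ1_to_AP` of line `Sketch` (crux stmt-Parity-11585): the
λ-form of the crux at `q = 1` for irreducible quadratics implies the λ-form along every AP.
Alias of `liouvilleQ1_to_liouvilleAP`. -/
theorem stub_liouvilleQ1_to_AP :
    (∀ f : ℤ[X], Irreducible f → f.natDegree = 2 → 0 < f.leadingCoeff →
      (fun x : ℕ => ∑ n ∈ Finset.Icc 1 x, (ArithmeticFunction.liouville ((f.eval (n : ℤ)).toNat) : ℝ))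
        =o[atTop] fun x : ℕ => (x : ℝ)) →
    ∀ f : ℤ[X], Irreducible f → f.natDegree = 2 → 0 < f.leadingCoeff → ∀ q a : ℕ, 0 < q →
      (fun x : ℕ => ∑ n ∈ (Finset.Icc 1 x).filter (fun n : ℕ => n ≡ a [MOD q]),
        (ArithmeticFunction.liouville ((f.eval (n : ℤ)).toNat) : ℝ)) =o[atTop] fun x : ℕ => (x : ℝ) :=
  liouvilleQ1_to_liouvilleAP

end Summit.Parity.BatemanHorn.Theorems
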